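import Summits.Parity.BatemanHorn.Theses.RoughValueTransport
import Literature.NumberTheory.Sieve.RoughCellDensity
import Literature.NumberTheory.Sieve.BatemanHornProofs
import Summits.Parity.BatemanHorn.Theorems.RoughValueTransportRoughValueLawRoughDecomposition
import HarnessLib

/-!
# Route `RoughValueTransport`, crux `RoughValueLaw` (stmt-Parity-11390), line
# `omega-class-shape-split`: the registered stub `stub_thinCells`

`--supports` file of the checked skeleton
`Summits/Parity/BatemanHorn/Cruxes/RoughValueLaw/Lines/omega_class_shape_split.lean` (reshape v5, lead
prover-line-stmt-Parity-11390-c1-0; crux `Summit.Parity.BatemanHorn.Theses.RoughValueTransport.RoughValueLaw`).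
The line sorts the jointly rough arguments `n ≤ x` of a Bateman–Horn system `f` (every `fᵢ(n) > 0` and free
of primes `< ⌈x^{deg fᵢ/u}⌉`) into Ω-CELLS `N_{f,r⃗}(x,u)` by the vector `r⃗ = (Ω(fᵢ(n)))ᵢ` and compares each
cell with the Hardy–Littlewood model `B_{r⃗ mod 2}(x)·∏ᵢ I_{rᵢ}(u)` (`I_j = roughCellDensity j`).  This file
PROVES the registered stub `stub_thinCells`, verbatim: on the THIN cells the comparison holds trivially, for
every amplitude table `B` —
* OVERSHOOT cells (`u < r_{i₀}` for some coordinate): every rough `n` has `Ω(fᵢ(n)) ≤ ⌊u⌋` once `x` is large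
  (all prime factors are `≥ x^{dᵢ/u}` while `fᵢ(n) ≪ x^{dᵢ}`; `ThinCells.eventually_cardFactors_le_floor`),
  so the cell is EMPTY eventually (`ThinCells.cell_eq_empty_eventually`), and `I_j(u) = 0` for `u < j`;
* MONIC coordinates at depth `u ≤ r_{i₀}`: `fᵢ₀(n) ≥ (x^{d/u})^{r} ≥ x^d` forces `x − H ≤ n ≤ x` with
  `H = Σ_{j<d} |coeff_j|` (`ThinCells.le_add_of_monic`), so the cell has at most `H + 1` members for EVERY `x`
  (`ThinCells.card_cell_le_of_monic`) — in particular the TOP cells `r_{i₀} = u ∈ ℕ` of a monic coordinate are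
  `O(1)` — and `I_j(u) = 0` for `u ≤ j`, `j ≥ 2`.
The lemmas are the recon worker's audit file for `stub_cellShapeGeneral` (this seat); the height bound
`Ω(fᵢ(n)) ≤ ⌊u⌋` is imported from the sibling file of `stub_roughDecomposition`
(`RoughDecomposition.eventually_cardFactors_le_floor`).  Everything used is PROVED; no definition, no named fact.
-/

namespace Summit.Parity.BatemanHorn.Cruxes.RoughValueLaw.OmegaClassShapeSplit

open Filter Finset Polynomial
open scoped BigOperators Topology ArithmeticFunction.Omega
open Literature.NumberTheory.Sieve

namespace ThinCells

/-! ### Overshoot cells (`rᵢ > u` for some `i`) are eventually empty -/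

/-- `N^{Ω(m)} ≤ m` when every prime factor of `m ≠ 0` is `≥ N`. [folklore] -/
theorem pow_cardFactors_le_of_rough {m N : ℕ} (hm : m ≠ 0)
    (hrough : ∀ p : ℕ, p.Prime → p ∣ m → N ≤ p) : N ^ Ω m ≤ m := by
  rw [ArithmeticFunction.cardFactors_apply]
  conv_rhs => rw [← Nat.prod_primeFactorsList hm]
  exact List.pow_card_le_prod _ _ fun p hp =>
    hrough p (Nat.prime_of_mem_primeFactorsList hp) (Nat.dvd_of_mem_primeFactorsList hp)

/-- A cell with some `r_{i₀} > ⌊u⌋` is eventually EMPTY (every rough `n ≤ x` has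
`Ω(fᵢ(n)) ≤ ⌊u⌋`, `eventually_cardFactors_le_floor`). [folklore] -/
theorem cell_eq_empty_eventually {k : ℕ} (f : Fin k → ℤ[X]) (hdeg : ∀ i, 0 < (f i).natDegree)
    {u : ℝ} (hu0 : 0 < u) (r : Fin k → ℕ) (i₀ : Fin k) (hi : ⌊u⌋₊ < r i₀) :
    ∀ᶠ x : ℕ in atTop, (Icc 1 x).filter (fun n : ℕ => (∀ i, 0 < (f i).eval (n : ℤ) ∧ ∀ p ∈
      range ⌈(x : ℝ) ^ (((f i).natDegree : ℝ) / u)⌉₊, p.Prime → ¬ ((p : ℤ) ∣ (f i).eval (n : ℤ)))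
      ∧ ∀ i, ArithmeticFunction.cardFactors ((f i).eval (n : ℤ)).toNat = r i) = ∅ := by
  filter_upwards [RoughDecomposition.eventually_cardFactors_le_floor f hdeg hu0] with x hx
  refine Finset.filter_false_of_mem fun n hn hcell => ?_
  have h1 := hx n hn hcell.1 i₀
  have h2 := hcell.2 i₀
  omega

/-- Hence on a cell with some `r_{i₀} > u` the stub's conclusion holds for EVERY amplitude `B`
(both the cell and the model density `∏ I_{rᵢ}(u)` vanish, the latter by `I_j(u) = 0` for
`u < j`). [folklore] -/
theorem tendsto_cell_of_lt {k : ℕ} (f : Fin k → ℤ[X]) (hf : IsBatemanHornSystem f)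
    (B : (Fin k → ℕ) → ℕ → ℝ) (r : Fin k → ℕ) {u : ℝ} (hu : 2 < u) (i₀ : Fin k)
    (hi : u < r i₀) :
    Tendsto (fun x : ℕ => (((Icc 1 x).filter (fun n : ℕ => (∀ i, 0 < (f i).eval (n : ℤ) ∧ ∀ p ∈
      range ⌈(x : ℝ) ^ (((f i).natDegree : ℝ) / u)⌉₊, p.Prime → ¬ ((p : ℤ) ∣ (f i).eval (n : ℤ)))
      ∧ ∀ i, ArithmeticFunction.cardFactors ((f i).eval (n : ℤ)).toNat = r i)).card : ℝ) *
      Real.log x ^ k / x - B (fun i => r i % 2) x * ∏ i, roughCellDensity (r i) u) atTop (𝓝 0) := by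
  have hu0 : 0 < u := by linarith
  have hfl : ⌊u⌋₊ < r i₀ := (Nat.floor_lt hu0.le).mpr hi
  have hprod : ∏ i, roughCellDensity (r i) u = 0 :=
    Finset.prod_eq_zero (Finset.mem_univ i₀) (roughCellDensity_of_lt _ hi)
  refine tendsto_const_nhds.congr' ?_
  filter_upwards [cell_eq_empty_eventually f hf.natDegree_pos hu0 r i₀ hfl] with x hx
  rw [hx, hprod, Finset.card_empty, Nat.cast_zero, zero_mul, zero_div, mul_zero, sub_zero]

/-! ### Depth `u ≤ rᵢ`: the model density vanishes; the content is "the cell is thin" -/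

/-- At a depth `u ≤ r_{i₀}` with `r_{i₀} ≥ 2` (in particular the TOP cell `r_{i₀} = u`, `u ∈ ℕ`)
the model density `∏ I_{rᵢ}(u)` is `0`, so the stub's conclusion for that cell says exactly
`N_{f,r⃗}(x,u)(log x)^k/x → 0`, whatever `B` is. [folklore] -/
theorem tendsto_cell_iff_of_le {k : ℕ} (f : Fin k → ℤ[X]) (B : (Fin k → ℕ) → ℕ → ℝ)
    (r : Fin k → ℕ) {u : ℝ} (i₀ : Fin k) (hi2 : 2 ≤ r i₀) (hi : u ≤ r i₀) :
    Tendsto (fun x : ℕ => (((Icc 1 x).filter (fun n : ℕ => (∀ i, 0 < (f i).eval (n : ℤ) ∧ ∀ p ∈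
      range ⌈(x : ℝ) ^ (((f i).natDegree : ℝ) / u)⌉₊, p.Prime → ¬ ((p : ℤ) ∣ (f i).eval (n : ℤ)))
      ∧ ∀ i, ArithmeticFunction.cardFactors ((f i).eval (n : ℤ)).toNat = r i)).card : ℝ) *
      Real.log x ^ k / x - B (fun i => r i % 2) x * ∏ i, roughCellDensity (r i) u) atTop (𝓝 0) ↔
    Tendsto (fun x : ℕ => (((Icc 1 x).filter (fun n : ℕ => (∀ i, 0 < (f i).eval (n : ℤ) ∧ ∀ p ∈
      range ⌈(x : ℝ) ^ (((f i).natDegree : ℝ) / u)⌉₊, p.Prime → ¬ ((p : ℤ) ∣ (f i).eval (n : ℤ)))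
      ∧ ∀ i, ArithmeticFunction.cardFactors ((f i).eval (n : ℤ)).toNat = r i)).card : ℝ) *
      Real.log x ^ k / x) atTop (𝓝 0) := by
  have hprod : ∏ i, roughCellDensity (r i) u = 0 :=
    Finset.prod_eq_zero (Finset.mem_univ i₀) (roughCellDensity_of_le hi2 hi)
  simp only [hprod, mul_zero, sub_zero]

/-! ### Monic coordinates: cells with `u ≤ r_{i₀}` have `O(1)` members -/

/-- In a cell with `u ≤ r` in a coordinate of degree `d`, the value satisfies `x^d ≤ P(n)`:
all `r` prime factors are `≥ ⌈x^{d/u}⌉`, so `P(n) ≥ (x^{d/u})^r ≥ (x^{d/u})^u = x^d`. [folklore] -/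
theorem pow_le_eval_of_cell (P : ℤ[X]) {u : ℝ} (hu0 : 0 < u) {r x n : ℕ} (hx : 1 ≤ x)
    (hr : u ≤ r) (hpos : 0 < P.eval (n : ℤ))
    (hsift : ∀ p ∈ range ⌈(x : ℝ) ^ ((P.natDegree : ℝ) / u)⌉₊, p.Prime → ¬ ((p : ℤ) ∣ P.eval (n : ℤ)))
    (hΩ : Ω (P.eval (n : ℤ)).toNat = r) :
    ((x : ℤ)) ^ P.natDegree ≤ P.eval (n : ℤ) := by
  set m : ℕ := (P.eval (n : ℤ)).toNat with hm
  have hmz : (m : ℤ) = P.eval (n : ℤ) := Int.toNat_of_nonneg hpos.le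
  have hm0 : m ≠ 0 := by
    intro h0; rw [h0] at hmz; simp at hmz; linarith
  set N : ℕ := ⌈(x : ℝ) ^ ((P.natDegree : ℝ) / u)⌉₊ with hN
  have h1 : N ^ r ≤ m := by
    rw [← hΩ]
    refine pow_cardFactors_le_of_rough hm0 fun p hp hpm => ?_
    by_contra hlt
    have hlt' : p < N := by omega
    refine hsift p (Finset.mem_range.mpr hlt') hp ?_
    rw [← hmz]
    exact_mod_cast hpm
  have hx1 : (1 : ℝ) ≤ x := by exact_mod_cast hx
  have hx0 : (0 : ℝ) ≤ x := by positivity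
  have hy1 : (1 : ℝ) ≤ (x : ℝ) ^ ((P.natDegree : ℝ) / u) := Real.one_le_rpow hx1 (by positivity)
  have h2 : ((x : ℝ)) ^ (P.natDegree : ℕ) ≤ (N : ℝ) ^ r :=
    calc ((x : ℝ)) ^ (P.natDegree : ℕ) = ((x : ℝ) ^ ((P.natDegree : ℝ) / u)) ^ (u : ℝ) := by
          rw [← Real.rpow_mul hx0, div_mul_cancel₀ _ hu0.ne', Real.rpow_natCast]
      _ ≤ ((x : ℝ) ^ ((P.natDegree : ℝ) / u)) ^ (r : ℝ) :=
          Real.rpow_le_rpow_of_exponent_le hy1 hr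
      _ = ((x : ℝ) ^ ((P.natDegree : ℝ) / u)) ^ r := Real.rpow_natCast _ _
      _ ≤ (N : ℝ) ^ r := pow_le_pow_left₀ (by positivity) (Nat.le_ceil _) _
  have h3 : ((x : ℝ)) ^ (P.natDegree : ℕ) ≤ (m : ℝ) := h2.trans (by exact_mod_cast h1)
  have h4 : x ^ P.natDegree ≤ m := by exact_mod_cast h3
  rw [← hmz]
  exact_mod_cast h4

/-- For MONIC `P` of degree `d ≥ 1` and `1 ≤ n ≤ x` with `x^d ≤ P(n)`, `x ≤ n + H` where
`H = Σ_{j<d} |coeff_j(P)|`: indeed `P(n) ≤ n·x^{d−1} + H·x^{d−1} < x^d` if `n + H < x`. [folklore] -/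
theorem le_add_of_monic (P : ℤ[X]) (hP : P.Monic) (hd : 0 < P.natDegree) {x n : ℕ}
    (hn1 : 1 ≤ n) (hnx : n ≤ x) (hval : ((x : ℤ)) ^ P.natDegree ≤ P.eval (n : ℤ)) :
    x ≤ n + ∑ j ∈ range P.natDegree, (P.coeff j).natAbs := by
  set d : ℕ := P.natDegree with hd_def
  set H : ℕ := ∑ j ∈ range d, (P.coeff j).natAbs with hH
  by_contra hlt
  push Not at hlt
  obtain ⟨e, he⟩ : ∃ e : ℕ, d = e + 1 := ⟨d - 1, by omega⟩
  have hx1 : (1 : ℤ) ≤ x := by exact_mod_cast hn1.trans hnx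
  have hnx' : (n : ℤ) ≤ x := by exact_mod_cast hnx
  have hn0 : (0 : ℤ) ≤ n := by positivity
  -- P(n) = n^d + Σ_{j<d} c_j n^j
  have heval : P.eval (n : ℤ) = (n : ℤ) ^ d + ∑ j ∈ range d, P.coeff j * (n : ℤ) ^ j := by
    rw [eval_eq_sum_range, ← hd_def, Finset.sum_range_succ]
    have hc : P.coeff d = 1 := hP.coeff_natDegree
    rw [hc, one_mul, add_comm]
  -- lower-order part ≤ H x^{d-1}
  have hlow : ∑ j ∈ range d, P.coeff j * (n : ℤ) ^ j ≤ (H : ℤ) * (x : ℤ) ^ e := by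
    rw [hH]
    push_cast
    rw [Finset.sum_mul]
    refine Finset.sum_le_sum fun j hj => ?_
    rw [Finset.mem_range] at hj
    calc P.coeff j * (n : ℤ) ^ j ≤ |P.coeff j * (n : ℤ) ^ j| := le_abs_self _
      _ = |P.coeff j| * (n : ℤ) ^ j := by rw [abs_mul, abs_pow, abs_of_nonneg hn0]
      _ ≤ |P.coeff j| * (x : ℤ) ^ e := by
          refine mul_le_mul_of_nonneg_left ?_ (abs_nonneg _)
          calc (n : ℤ) ^ j ≤ (x : ℤ) ^ j := by gcongr
            _ ≤ (x : ℤ) ^ e := pow_le_pow_right₀ hx1 (by omega)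
  -- top part ≤ n x^{d-1}
  have htop : (n : ℤ) ^ d ≤ (n : ℤ) * (x : ℤ) ^ e := by
    rw [he, pow_succ, mul_comm]
    gcongr
  have hsum : P.eval (n : ℤ) ≤ ((n : ℤ) + H) * (x : ℤ) ^ e := by
    rw [heval, add_mul]
    exact add_le_add htop hlow
  have hlt' : ((n : ℤ) + H) * (x : ℤ) ^ e < (x : ℤ) ^ d := by
    rw [he, pow_succ, mul_comm ((x : ℤ) ^ e)]
    have hxe : (0 : ℤ) < (x : ℤ) ^ e := by positivity
    have h' : (n : ℤ) + H < x := by exact_mod_cast hlt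
    exact mul_lt_mul_of_pos_right h' hxe
  have := (hval.trans hsum).trans_lt hlt'
  rw [hd_def] at this
  exact lt_irrefl _ this

/-- **Monic coordinates: cells at depth `u ≤ r_{i₀}` have at most `H + 1` members**, for every `x`
(`H = Σ_{j < deg f_{i₀}} |coeff_j|`): the counted `n` satisfy `x − H ≤ n ≤ x`. In particular the TOP
cells `r_{i₀} = u` (`u ∈ ℕ`) of a monic coordinate are `O(1)`. [folklore] -/
theorem card_cell_le_of_monic {k : ℕ} (f : Fin k → ℤ[X]) (i₀ : Fin k) (hmon : (f i₀).Monic)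
    (hd : 0 < (f i₀).natDegree) (r : Fin k → ℕ) {u : ℝ} (hu0 : 0 < u) (hi : u ≤ r i₀) (x : ℕ) :
    ((Icc 1 x).filter (fun n : ℕ => (∀ i, 0 < (f i).eval (n : ℤ) ∧ ∀ p ∈
      range ⌈(x : ℝ) ^ (((f i).natDegree : ℝ) / u)⌉₊, p.Prime → ¬ ((p : ℤ) ∣ (f i).eval (n : ℤ)))
      ∧ ∀ i, ArithmeticFunction.cardFactors ((f i).eval (n : ℤ)).toNat = r i)).card ≤
      ∑ j ∈ range (f i₀).natDegree, ((f i₀).coeff j).natAbs + 1 := by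
  set H : ℕ := ∑ j ∈ range (f i₀).natDegree, ((f i₀).coeff j).natAbs with hH
  calc _ ≤ (Icc (x - H) x).card := by
        refine Finset.card_le_card fun n hn => ?_
        rw [Finset.mem_filter, Finset.mem_Icc] at hn
        obtain ⟨⟨hn1, hnx⟩, hrough, hΩ⟩ := hn
        have hx : 1 ≤ x := hn1.trans hnx
        have hval := pow_le_eval_of_cell (f i₀) hu0 hx hi (hrough i₀).1 (hrough i₀).2 (hΩ i₀)
        have hle := le_add_of_monic (f i₀) hmon hd hn1 hnx hval
        rw [Finset.mem_Icc]
        exact ⟨by omega, hnx⟩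
    _ = x + 1 - (x - H) := Nat.card_Icc _ _
    _ ≤ H + 1 := by omega

/-- `(log x)^k / x → 0` along `ℕ`. [folklore] -/
theorem tendsto_log_pow_div_self (k : ℕ) :
    Tendsto (fun x : ℕ => Real.log x ^ k / (x : ℝ)) atTop (𝓝 0) := by
  have h1 : Tendsto (fun x : ℝ => Real.log x ^ k / x) atTop (𝓝 0) := by
    simpa using Real.tendsto_pow_log_div_mul_add_atTop 1 0 k one_ne_zero
  exact h1.comp tendsto_natCast_atTop_atTop

/-- **Monic coordinates: the stub's conclusion holds, for EVERY `B`, on all cells with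
`u ≤ r_{i₀}`** (`f_{i₀}` monic): the cell is `O(1)` (`card_cell_le_of_monic`) and the model density
vanishes (`I_j(u) = 0` for `u ≤ j`, `j ≥ 2`). [folklore] -/
theorem tendsto_cell_of_monic {k : ℕ} (f : Fin k → ℤ[X]) (hf : IsBatemanHornSystem f)
    (i₀ : Fin k) (hmon : (f i₀).Monic) (B : (Fin k → ℕ) → ℕ → ℝ) (r : Fin k → ℕ) {u : ℝ}
    (hu : 2 < u) (hi : u ≤ r i₀) :
    Tendsto (fun x : ℕ => (((Icc 1 x).filter (fun n : ℕ => (∀ i, 0 < (f i).eval (n : ℤ) ∧ ∀ p ∈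
      range ⌈(x : ℝ) ^ (((f i).natDegree : ℝ) / u)⌉₊, p.Prime → ¬ ((p : ℤ) ∣ (f i).eval (n : ℤ)))
      ∧ ∀ i, ArithmeticFunction.cardFactors ((f i).eval (n : ℤ)).toNat = r i)).card : ℝ) *
      Real.log x ^ k / x - B (fun i => r i % 2) x * ∏ i, roughCellDensity (r i) u) atTop (𝓝 0) := by
  have hu0 : 0 < u := by linarith
  have hi2 : 2 ≤ r i₀ := by
    have : (2 : ℝ) < r i₀ := hu.trans_le hi
    exact_mod_cast this.le
  rw [tendsto_cell_iff_of_le f B r i₀ hi2 hi]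
  set H : ℕ := ∑ j ∈ range (f i₀).natDegree, ((f i₀).coeff j).natAbs with hH
  have h0 : Tendsto (fun x : ℕ => ((H + 1 : ℕ) : ℝ) * (Real.log x ^ k / (x : ℝ))) atTop (𝓝 0) := by
    simpa using (tendsto_log_pow_div_self k).const_mul ((H + 1 : ℕ) : ℝ)
  refine squeeze_zero_norm' ?_ h0
  filter_upwards [eventually_gt_atTop 1] with x hx1
  have hx1' : (1 : ℝ) < x := by exact_mod_cast hx1
  have hL : 0 ≤ Real.log x ^ k / (x : ℝ) :=
    div_nonneg (pow_nonneg (Real.log_nonneg hx1'.le) k) (by positivity)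
  have hcard := card_cell_le_of_monic f i₀ hmon (hf.natDegree_pos i₀) r hu0 hi x
  rw [Real.norm_eq_abs, mul_div_assoc, abs_mul, abs_of_nonneg hL, Nat.abs_cast]
  exact mul_le_mul_of_nonneg_right (by exact_mod_cast hcard) hL

end ThinCells

/-- **stub_thinCells** (registered stub of the skeleton
`Cruxes/RoughValueLaw/Lines/omega_class_shape_split.lean`, reshape v5, crux stmt-Parity-11390).
On the THIN cells — an overshoot coordinate `u < r_{i₀}` (the cell is empty eventually,
`ThinCells.tendsto_cell_of_lt`) or a MONIC coordinate at depth `u ≤ r_{i₀}` (the cell has at most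
`H + 1` members, `ThinCells.card_cell_le_of_monic`) — the model density `∏ᵢ I_{rᵢ}(u)` vanishes and the
cell-shape conclusion holds for EVERY amplitude table `B`. [folklore] -/
theorem stub_thinCells :
    ∀ (k : ℕ) (f : Fin k → ℤ[X]), IsBatemanHornSystem f → ∀ B : (Fin k → ℕ) → ℕ → ℝ, ∀ r : Fin k
      → ℕ, ∀ u : ℝ, 2 < u → ((∃ i, u < (r i : ℝ)) ∨ (∃ i, (f i).Monic ∧ u ≤ (r i : ℝ))) →
      Tendsto (fun x : ℕ => (((Icc 1 x).filter (fun n : ℕ => (∀ i, 0 < (f i).eval (n : ℤ) ∧ ∀ p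
      ∈ range ⌈(x : ℝ) ^ (((f i).natDegree : ℝ) / u)⌉₊, p.Prime → ¬ ((p : ℤ) ∣ (f i).eval (n :
      ℤ))) ∧ ∀ i, ArithmeticFunction.cardFactors ((f i).eval (n : ℤ)).toNat = r i)).card : ℝ) *
      Real.log x ^ k / x - B (fun i => r i % 2) x * ∏ i, roughCellDensity (r i) u) atTop (𝓝 0) := by
  intro k f hf B r u hu hthin
  rcases hthin with ⟨i₀, hi⟩ | ⟨i₀, hmon, hi⟩
  · exact ThinCells.tendsto_cell_of_lt f hf B r hu i₀ hi
  · exact ThinCells.tendsto_cell_of_monic f hf i₀ hmon B r hu hi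

end Summit.Parity.BatemanHorn.Cruxes.RoughValueLaw.OmegaClassShapeSplit
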